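import Literature.NumberTheory.GaloisCohomology.Howard2004.KolyvaginSystemRescalingProofs
import Literature.NumberTheory.GaloisCohomology.Howard2004.PropagateTowerProofs
import HarnessLib

/-!
# Howard 2004, Def. 1.2.3: rescaling Kolyvagin systems of a `DVRSetting` by LEVELWISE units (theorems only)

Topic `NumberTheory/GaloisCohomology/Howard2004` (sequel to `KolyvaginSystemRescalingProofs`, whose §4
`DVRSetting.exists_kolyvaginSystem_smul_of_isRescaledFs` takes ONE scalar `u_ℓ ∈ R` per prime read at every level).
THEOREMS ONLY: no definition, no named fact, no instance, no notation, no `sorry`.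

WHY (INPUTS row G87 = `Howard2004.thm161_dvrKolyvaginBound` = Howard Thm. 1.6.1; stub `stub_h161` of the μ-crux
stmt-BirchSwinnertonDyer-22642; cell `pub/bsd-print-x9`, seat `bsd-line-x10b-p1-w7` g8, brick (TAME-WLOG)).  The units
relating two admissible slot families are produced per level (`FiniteSingularSlotUnitsLevelwiseProofs`:
`u_k, w_k : 𝓛 → R_k`, with `red(w_{k+1} ℓ)` and `w_k ℓ` acting identically on `T^{(k)}/I_n`); this file transports
Kolyvagin systems along such LEVELWISE rescalings: `κ″^{(k)}_n := (∏_{ℓ ∣ n} w_k ℓ) · κ^{(k)}_n`.  The (ks) relations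
at each level are `LevelData.smulClasses_mem_KS_of_isRescaledFs` as before; the compatibility with the reductions
`T^{(k+1)}/I_n → T^{(k)}/I_n` uses only that the two product scalars act identically on `T^{(k)}/I_n`
(`hcompat`), read on `H¹` by functoriality; off `𝓝(𝓛)` both families vanish.

* `scalarMapH1_eq_of_forall_smul_eq` (generic: scalars acting identically induce the same `H¹(·•)`),
  `DVRSetting.rqH1_scalarMapH1_level` (`rqH1 ∘ H¹(a•) = H¹(red a •) ∘ rqH1` for `a ∈ R_{k+1}`),
  **`DVRSetting.exists_kolyvaginSystem_smul_of_isRescaledFs_levelwise`** — output: a `S.KolyvaginSystem` for the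
  slots of `S` with THE SAME bottom class `one`.

HONEST FRAMING: `thm161_dvrKolyvaginBound` is NOT proved; no summit statement is proved; the Birch–Swinnerton-Dyer
conjecture is not proved by any of this.
References: [Howard2004HeegnerKolyvagin] B. Howard, Compositio Math. 140 (2004), Def. 1.2.3 with display (ks
relations), Thm. 1.6.1, Thm. 1.7.5 (arXiv:1202.6340 p. 6 L126 – p. 7 L12, p. 11 L23–28, p. 14 L30–44);
[SerreGaloisCohomology1997] I §2.2.
-/

set_option autoImplicit false

noncomputable section

open Function NumberField IsDedekindDomain Field
open scoped NumberField ContRepresentation Classical TensorProduct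

namespace Literature.NumberTheory.GaloisCohomology.Howard2004

open Literature.NumberTheory.GaloisRepresentations
open Literature.NumberTheory.GaloisRepresentations.DiscreteGaloisModule
open Literature.NumberTheory.GaloisRepresentations.galoisCohomology

/-- Tensor bookkeeping: `(F ⊗ 1) ∘ (σ_A ⊗ 1) = (σ_B ⊗ 1) ∘ (F ⊗ 1)` when `F ∘ σ_A = σ_B ∘ F`. [folklore] -/
private theorem map_map_of_comp_eq' {A B G : Type} [AddCommGroup A] [AddCommGroup B]
    {_ : AddCommMonoid G} {_ : Module ℤ G} (F : A →+ B) (σA : A →+ A) (σB : B →+ B)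
    (h : F.comp σA = σB.comp F) (x : A ⊗[ℤ] G) :
    TensorProduct.map F.toIntLinearMap LinearMap.id
        (TensorProduct.map σA.toIntLinearMap LinearMap.id x) =
      TensorProduct.map σB.toIntLinearMap LinearMap.id
        (TensorProduct.map F.toIntLinearMap LinearMap.id x) := by
  induction x using TensorProduct.induction_on with
  | zero => simp only [map_zero]
  | add x y hx hy => simp only [map_add, hx, hy]
  | tmul a g =>
    simp only [TensorProduct.map_tmul, AddMonoidHom.coe_toIntLinearMap, LinearMap.id_coe, id_eq]
    rw [← AddMonoidHom.comp_apply, h, AddMonoidHom.comp_apply]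


section Generic

variable {K : Type} [Field K] {A : Type} [CommRing A] {X : Type} [AddCommGroup X]
  [TopologicalSpace X] [DiscreteTopology X] [Module A X]

/-- Two scalars acting identically on the module induce the same map `H¹(a•) = H¹(b•)`.
[cite: SerreGaloisCohomology1997, Ch. I §2.2 (functoriality)] -/
theorem scalarMapH1_eq_of_forall_smul_eq (τ : DiscreteGaloisModule K X) (hτ : τ.IsScalarLinear A)
    {a b : A} (h : ∀ y : X, a • y = b • y) (x : galoisCohomology τ 1) :
    scalarMapH1 τ hτ a x = scalarMapH1 τ hτ b x := by
  have hab : scalarIntertwining τ hτ a = scalarIntertwining τ hτ b :=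
    ContIntertwiningMap.ext (ContinuousLinearMap.ext fun y => h y)
  unfold scalarMapH1 scalarMap
  rw [hab]

omit [TopologicalSpace X] [DiscreteTopology X] in
/-- Products of scalars acting identically factorwise act identically. [folklore] -/
private theorem prod_smul_eq_prod_smul {ι : Type} (a b : ι → A) (n : Finset ι)
    (h : ∀ v ∈ n, ∀ y : X, a v • y = b v • y) (y : X) :
    (∏ v ∈ n, a v) • y = (∏ v ∈ n, b v) • y := by
  induction n using Finset.induction_on generalizing y with
  | empty => simp
  | insert v n hvn ih =>
    rw [Finset.prod_insert hvn, Finset.prod_insert hvn, mul_smul, mul_smul,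
      ih (fun w hw z => h w (Finset.mem_insert_of_mem hw) z), h v (Finset.mem_insert_self v n)]

end Generic

section DVR

variable {p : ℕ} [Fact p.Prime] {K : Type} [Field K] [NumberField K]
  {R : Type} [CommRing R] [IsDomain R] [IsDiscreteValuationRing R] [Algebra ℤ_[p] R]
  {N : ℕ → Type} [∀ k, AddCommGroup (N k)] [∀ k, TopologicalSpace (N k)]
  [∀ k, DiscreteTopology (N k)] [∀ k, Module R (N k)]
  {Rk : ℕ → Type} [∀ k, CommRing (Rk k)] [∀ k, IsLocalRing (Rk k)] [∀ k, TopologicalSpace (Rk k)]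
  [∀ k, DiscreteTopology (Rk k)] [∀ k, Algebra ℤ_[p] (Rk k)] [∀ k, Algebra R (Rk k)]
  [∀ k, Module (Rk k) (N k)] [∀ k, IsScalarTower R (Rk k) (N k)]
  {Nbar : Type} [AddCommGroup Nbar] [TopologicalSpace Nbar] [DiscreteTopology Nbar]
  [∀ k, Module (Rk k) Nbar]
  {Nq : ℕ → Finset (HeightOneSpectrum (𝓞 K)) → Type} [∀ k n, AddCommGroup (Nq k n)]
  [∀ k n, TopologicalSpace (Nq k n)] [∀ k n, DiscreteTopology (Nq k n)]
  [∀ k n, Module (Rk k) (Nq k n)] [∀ k n, Module R (Nq k n)]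
  [∀ k n, IsScalarTower R (Rk k) (Nq k n)]

namespace DVRSetting

/-- **The reductions `T^{(k+1)}/I_n → T^{(k)}/I_n` on `H¹` intertwine a level-`(k+1)` scalar with its reduction**
(`a = algebraMap r`, `redR (algebraMap r) = algebraMap r`). [cite: Howard2004HeegnerKolyvagin, §1.6 (arXiv p. 11, L45–50)] -/
theorem rqH1_scalarMapH1_level (S : DVRSetting p K R N Rk Nbar Nq) (hy : S.SatisfiesH) (k : ℕ)
    (n : Finset (HeightOneSpectrum (𝓞 K))) (a : Rk (k + 1)) (x : galoisCohomology ((S.LD (k + 1)).ρq n) 1) :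
    S.rqH1 k n (scalarMapH1 ((S.LD (k + 1)).ρq n) ((S.LD (k + 1)).isScalarLinear (hy.scalarLinear (k + 1)) n)
        a x) =
      scalarMapH1 ((S.LD k).ρq n) ((S.LD k).isScalarLinear (hy.scalarLinear k) n) (S.redR k a)
        (S.rqH1 k n x) := by
  obtain ⟨r, rfl⟩ := hy.algebraMap_surjective (k + 1) a
  rw [hy.redR_comp]
  exact S.rqH1_scalarMapH1 hy.scalarLinear k n r x

set_option maxHeartbeats 400000 in
/-- **Rescaling a Kolyvagin system of the DVR-level triple by LEVELWISE units.**  As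
`exists_kolyvaginSystem_smul_of_isRescaledFs`, but with the units `u_k ℓ`, `w_k ℓ ∈ R_k` (`w_k u_k = 1`) depending on
the level, subject only to «`red(w_{k+1} ℓ)` and `w_k ℓ` act identically on `T^{(k)}/I_n` for `λ ∈ n ∈ 𝓝(𝓛)`» — which
is all the compatibility of the rescaled classes `κ″^{(k)}_n := (∏_{ℓ∣n} w_k ℓ) κ^{(k)}_n` with the reductions uses
(`T^{(k)}/I_n` is killed by `I_n`).  Output: a `S.KolyvaginSystem` (for the slots of `S`) with the same bottom class.
[cite: Howard2004HeegnerKolyvagin, Def. 1.2.3 and Thm. 1.6.1 (arXiv p. 7 L1–12, p. 11 L23–28); cf. Thm. 1.7.5 (p. 14, L30–44)] -/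
theorem exists_kolyvaginSystem_smul_of_isRescaledFs_levelwise (S : DVRSetting p K R N Rk Nbar Nq)
    (hy : S.SatisfiesH)
    (hst : ∀ k, (S.LD k).IsSelmerScalarStable S.jbar (hy.scalarLinear k))
    (hnat : ∀ k (n : Finset (HeightOneSpectrum (𝓞 K))) (v : HeightOneSpectrum (𝓞 K)), v ∉ n →
      insert v n ∈ (S.t k).levelSet → (S.LD k).FsScalarNaturalAt (hy.scalarLinear k) (insert v n) v)
    (fs₂ : ∀ k (n : Finset (HeightOneSpectrum (𝓞 K))) (v : HeightOneSpectrum (𝓞 K)),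
      galoisCohomology (((S.LD k).ρq n).toLocal (Sum.inr v)) 1 →+
        SingularQuotient (GaloisRep.toLocal v ((S.LD k).ρq n)) ⊗[ℤ] Gell v)
    (u w : ∀ k, HeightOneSpectrum (𝓞 K) → Rk k) (hwu : ∀ k v, w k v * u k v = 1)
    (hrel : ∀ k, (S.LD k).IsRescaledFs (hy.scalarLinear k) (fs₂ k) (u k))
    (hcompat : ∀ k (n : Finset (HeightOneSpectrum (𝓞 K))), n ∈ (S.t k).levelSet → ∀ v ∈ n, ∀ y : Nq k n,
      S.redR k (w (k + 1) v) • y = w k v • y)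
    (κ : ∀ k (n : Finset (HeightOneSpectrum (𝓞 K))), ↥((S.LD k).selmerAt S.jbar n) ⊗[ℤ] Gn (K := K) n)
    (hks : ∀ k, κ k ∈ ({ S.LD k with fs := fs₂ k } : LevelData (Rk k) (S.T.ρ k) (S.t k) (Nq k)).KS S.jbar)
    (hred : ∀ k n,
      TensorProduct.map ((S.rqH1 k n).comp ((S.LD (k + 1)).selmerAt S.jbar n).subtype).toIntLinearMap
          LinearMap.id (κ (k + 1) n) =
        TensorProduct.map ((S.LD k).selmerAt S.jbar n).subtype.toIntLinearMap LinearMap.id (κ k n))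
    (one : ∀ k, galoisCohomology (S.T.ρ k) 1) (hone : one ∈ S.T.limitSelmer fun k => (S.t k).cond)
    (hκone : ∀ k, TensorProduct.map ((S.LD k).selmerAt S.jbar ∅).subtype.toIntLinearMap LinearMap.id
        (κ k ∅) =
      ((S.LD k).isQuotientBy ∅).cohomologyMap 1 (one k) ⊗ₜ[ℤ] (gnEmptyEquiv (K := K)).symm 1) :
    ∃ κ' : S.KolyvaginSystem, κ'.one = one ∧ ∀ k n, κ'.κ k n =
      (S.LD k).smulClasses S.jbar (hy.scalarLinear k) (hst k) (fun n => ∏ v ∈ n, w k v) (κ k) n := by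
  refine ⟨{ κ := fun k => (S.LD k).smulClasses S.jbar (hy.scalarLinear k) (hst k) (fun n => ∏ v ∈ n, w k v) (κ k)
            ks := fun k => (S.LD k).smulClasses_mem_KS_of_isRescaledFs S.jbar (hy.scalarLinear k) (hst k)
              (hnat k) (hrel k) _ (hwu k) (hks k)
            κ_red := fun k n => ?_
            one := one
            one_mem := hone
            κ_one := fun k => ?_ }, rfl, fun k n => rfl⟩
  · -- compatibility with the reductions
    by_cases hn : n ∈ (S.t k).levelSet
    · -- `rqH1 ∘ (c_{k+1} •) = (red c_{k+1} •) ∘ rqH1 = (c_k •) ∘ rqH1` on `H¹(K, T^{(k+1)}/I_n)`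
      have hsc : ∀ x : galoisCohomology ((S.LD k).ρq n) 1,
          scalarMapH1 ((S.LD k).ρq n) ((S.LD k).isScalarLinear (hy.scalarLinear k) n)
              (S.redR k (∏ v ∈ n, w (k + 1) v)) x =
            scalarMapH1 ((S.LD k).ρq n) ((S.LD k).isScalarLinear (hy.scalarLinear k) n) (∏ v ∈ n, w k v) x := by
        intro x
        refine scalarMapH1_eq_of_forall_smul_eq _ _ (fun y => ?_) x
        rw [map_prod]
        exact prod_smul_eq_prod_smul _ _ n (fun v hv z => hcompat k n hn v hv z) y
      have h1 : ((S.rqH1 k n).comp ((S.LD (k + 1)).selmerAt S.jbar n).subtype).comp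
          ((S.LD (k + 1)).selmerAtSMul S.jbar (hy.scalarLinear (k + 1)) (hst (k + 1)) n
            (∏ v ∈ n, w (k + 1) v)) =
          (scalarMapH1 ((S.LD k).ρq n) ((S.LD k).isScalarLinear (hy.scalarLinear k) n)
              (∏ v ∈ n, w k v)).comp
            ((S.rqH1 k n).comp ((S.LD (k + 1)).selmerAt S.jbar n).subtype) := by
        refine AddMonoidHom.ext fun x => ?_
        change S.rqH1 k n (((S.LD (k + 1)).selmerAtSMul S.jbar (hy.scalarLinear (k + 1)) (hst (k + 1)) n
            (∏ v ∈ n, w (k + 1) v) x : ↥((S.LD (k + 1)).selmerAt S.jbar n)) :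
              galoisCohomology ((S.LD (k + 1)).ρq n) 1) =
          scalarMapH1 ((S.LD k).ρq n) ((S.LD k).isScalarLinear (hy.scalarLinear k) n)
            (∏ v ∈ n, w k v) (S.rqH1 k n (x : galoisCohomology ((S.LD (k + 1)).ρq n) 1))
        rw [LevelData.coe_selmerAtSMul, S.rqH1_scalarMapH1_level hy, hsc]
      have h2 : ((S.LD k).selmerAt S.jbar n).subtype.comp
          ((S.LD k).selmerAtSMul S.jbar (hy.scalarLinear k) (hst k) n (∏ v ∈ n, w k v)) =
          (scalarMapH1 ((S.LD k).ρq n) ((S.LD k).isScalarLinear (hy.scalarLinear k) n)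
              (∏ v ∈ n, w k v)).comp ((S.LD k).selmerAt S.jbar n).subtype :=
        AddMonoidHom.ext fun _ => rfl
      refine (map_map_of_comp_eq' _ _ _ h1 (κ (k + 1) n)).trans ?_
      refine (congrArg (TensorProduct.map (scalarMapH1 ((S.LD k).ρq n)
        ((S.LD k).isScalarLinear (hy.scalarLinear k) n) (∏ v ∈ n, w k v)).toIntLinearMap
          LinearMap.id) (hred k n)).trans ?_
      exact (map_map_of_comp_eq' _ _ _ h2 (κ k n)).symm
    · -- off `𝓝(𝓛)` both families vanish
      have hn' : n ∉ (S.t (k + 1)).levelSet := by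
        change n ∉ levels (S.t (k + 1)).primes
        rw [hy.primes_eq]
        change n ∉ levels (S.t k).primes at hn
        rwa [hy.primes_eq] at hn
      have h0 : κ k n = 0 := (hks k).2 n hn
      have h0' : κ (k + 1) n = 0 := (hks (k + 1)).2 n hn'
      rw [LevelData.smulClasses_apply, LevelData.smulClasses_apply, h0, h0', map_zero, map_zero, map_zero, map_zero]
  · -- the bottom class: `c(1) = 1`
    rw [LevelData.smulClasses_prod_empty]
    exact hκone k

end DVRSetting

end DVR

end Literature.NumberTheory.GaloisCohomology.Howard2004

end
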